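import Summits.BirchSwinnertonDyer.BirchSwinnertonDyer.Theorems.AlignedTransportAtTwoMainConjectureOfRankZeroBSDAtTwoHalfDescent
import HarnessLib

/-!
# Route `AlignedTransportAtTwo`, crux C2 `MainConjectureOfRankZeroBSDAtTwo` (stmt-BirchSwinnertonDyer-22298):
# THE HALF-DEGREE DESCENT, II: VALUES — `P(x − 1) = x^m · h(x + x⁻¹)`; every layer value of an `ι`-stable `F ∈ ℤ_p⟦T⟧` is a value of its
# real counterpart `h` (degree `λ/2`) on the REAL cyclotomic tower: `|F(ζ − 1)| = p^{−μ(F)}·|h(ζ + ζ⁻¹)|`; `F(0) ~ h(2)`, `F(−2) ~ ±h(−2)`,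
# order `4` reads `h(0)`, order `8` reads `h(±√2)`; at odd `p` the degree `λ` is automatically even

HONEST FRAMING (cell `bsd-f1-sign2`, WIDTH-5 attached prover seat `bsd-line-att-p5` gen 51 on line `birth` of the lead `bsd-line-att-p2`;
`--supports` stmt-BirchSwinnertonDyer-22298, closes nothing; BSD is NOT proved by any of this; the crux C2, its verdict «blocked-on
`Rank1Residual.GreenbergMuConjectureIrreducible`» and every registered stub are untouched). THEOREMS ONLY — no `def`, no instance, no named fact,
no `sorry`. Sequel of `…HalfDescent` (p824762: `P(X − 1) = ∑ b_j X^{m−j}(X²+1)^j` for a unique monic `h = ∑ b_j Y^j` of degree `m = λ/2`).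

THE POINT. The lineage reads `μ₂ = 0` off special values of a generator `f_X` of `char_Λ X(W/ℚ_∞)` — the Euler weight `ord₂ f_X(0)` (g33), the
twin value `ord₂ f_X(−2)` (g49), the layer values `‖f_X(ζ_{2ⁿ⁺¹} − 1)‖₂` (g50). With the real counterpart `h` ALL of these are values of ONE
polynomial of HALF the degree at `p`-adic (indeed rational-integer / real-cyclotomic) points:
* §1 (any commutative ring) ★★ `eval₂_sub_one_eq` (**`P(x − 1) = x^m·h(x + x⁻¹)`** for every unit `x` of every algebra); `eval_zero_eq` (`P(0) = h(2)`),
  `eval_neg_two_eq` (`P(−2) = (−1)^m h(−2)`), `eval₂_sub_one_eq_of_sq_eq_neg_one` (`ζ² = −1`: `P(ζ−1) = ζ^m·h(0)`),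
  `eval₂_sub_one_eq_of_pow_four_eq_neg_one` (`ζ⁴ = −1`: `P(ζ−1) = ζ^m·h(s)`, `s = ζ − ζ³`, `s² = 2`).
* §2 ★★ `even_natDegree_weierstrassDistinguished_of_odd_prime`: `p ≠ 2`, `F ≢ 0`, `F(0) ≠ 0`, `ι F = uF` ⟹ `λ` even (`P(−2) ≡ (−2)^λ ≢ 0`, versus
  `…LayerValuePalindrome`: odd `λ` ⟹ `P(−2) = 0`). At `p = 2` evenness is the parity `F(−2) ≠ 0` (g49 `even_lam_of_iotaStable'`; Matsuno 2008 Prop. 6.4).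
* §3 (`ℂ_p`) ★★★ **`norm_tsum_eq_norm_realCounterpart`**: `F ≠ 0` `ι`-stable, `F(0) ≠ 0`, `λ(F) = 2m`, `|ζ| = 1`, `|ζ − 1| < 1` ⟹
  **`|F(ζ − 1)| = p^{−μ(F)}·|h(ζ + ζ⁻¹)|`**; `…_of_isPrimitiveRoot` (every layer of the tree's certificates `Iwasawa/LambdaInvariantValuationLayer`,
  `…LayerValueDoor`); ★★★ `norm_tsum_eq_norm_coeff_zero_of_sq_eq_neg_one` (**the order-`4` value is `p^{−μ}·|h(0)|`** — at `p = 2` the LAYER-2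
  value of the lineage is the absolute value of the `2`-adic INTEGER `h(0)`; in particular `ord₂ f_X(ζ₄ − 1) ∈ ℤ`, not merely `½ℤ`).
* §4 (`ℤ_p`-points) ★★ `constantCoeff_eq_pow_mu_mul_eval_two` (**`F(0) = p^μ·h(2)·unit`**: Euler weight `= μ + v(h(2))`);
  ★★ `evalAt_neg_two_eq_pow_mu_mul_eval_neg_two` (`p = 2`: **`F(−2) = 2^μ·(−1)^m h(−2)·unit`**: twin value `= μ + v(h(−2))`).
So the lineage's three dyadic data (weight, twin, layer 2) are `μ + ord₂` of `h(2)`, `h(−2)`, `h(0)`, and layer `3` reads `h(±√2)`: for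
`λ = 2`, `h = Y + c`: `(c + 2, c − 2, c)` — g49/g50's twin table `(v(q), v(q − 4))` with `q = c + 2` and the layer-2 boundary `v(c) = 1 ⟺ v(q) ≥ 2`;
for `λ = 4`, `h = Y² + c₁Y + c₀`: `(4 + 2c₁ + c₀, 4 − 2c₁ + c₀, c₀)` and `h(√2) = 2 + c₀ + c₁√2` (sibling `…HalfDescentAtTwo` for the tables).
BSD is not proved by any of this; nothing about any curve is asserted here. Memo `Cruxes/MainConjectureOfRankZeroBSDAtTwo/HALF-DESCENT-att-p5-g51.md`.

References: M. Goresky, Y.-S. Tai, arXiv:1701.07742, App. §16.2 Prop. 36 [GoreskyTai2017RealStructuresOrdinary]; L. Washington, GTM 83, §7.1–7.2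
[Washington1997]; B. Mazur, J. Tate, J. Teitelbaum, Invent. Math. 84 (1986) Ch. I §17 [MazurTateTeitelbaum1986Invent]; R. Greenberg, LNM 1716 (1999)
§5 p. 181 [GreenbergLNM1716]; K. Matsuno, IJNT 4 (2008) Prop. 6.4 [Matsuno2008].
-/

set_option linter.dupNamespace false
set_option autoImplicit false

noncomputable section

open scoped Classical

namespace Summit.BirchSwinnertonDyer.BirchSwinnertonDyer.Theorems.AlignedTransportAtTwoHalfDescentValues

open PowerSeries Literature.NumberTheory.EllipticCurves
  Literature.NumberTheory.EllipticCurves.IwasawaAlgebra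
  Literature.Algebra.Polynomial.QPalindromicRealCounterpart
  Summit.BirchSwinnertonDyer.Rank1Residual.X1.MuLambda
  Summit.BirchSwinnertonDyer.Rank1Residual.Iwasawa
  Summit.BirchSwinnertonDyer.Rank1Residual.Supersingular
  Summit.BirchSwinnertonDyer.Rank1Residual.Supersingular.BlindLever
  Summit.BirchSwinnertonDyer.BirchSwinnertonDyer.Theorems.AlignedTransportAtTwoLayerValuePalindrome
  Summit.BirchSwinnertonDyer.BirchSwinnertonDyer.Theorems.AlignedTransportAtTwoHalfDescent

/-! ## §1 The value law `P(x − 1) = x^m · h(x + x⁻¹)` (any commutative ring) -/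

section Values

variable {R : Type*} [CommRing R]

/-- ★★ **THE VALUE LAW `P(x − 1) = x^m · h(x + x⁻¹)`** for every unit `x` of every commutative `R`-algebra `f : R → S`: if
`P(X − 1) = ∑_{j ≤ m} b_j X^{m−j}(X²+1)^j` with `deg h ≤ m` then `P(x − 1) = x^m·h(x + x⁻¹)` (read through `f`). For the distinguished
polynomial of an `ι`-stable element of `Λ` this says: **every special value at `T = ζ − 1` descends to the real counterpart `h` at
`ζ + ζ⁻¹`** — the trivial character (`ζ = 1`: `P(0) = h(2)`), the order-`2` character (`ζ = −1`: `P(−2) = (−1)^m h(−2)`), and every layer of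
the cyclotomic tower (`ζ` of order `pⁿ⁺¹`: `|P(ζ − 1)| = |h(ζ + ζ⁻¹)|`, `ζ + ζ⁻¹` in the REAL cyclotomic field).
[cite: GoreskyTai2017RealStructuresOrdinary, App. §16.1–§16.2 «p(x) = xⁿ h(x + q/x)» (p0036)] -/
theorem eval₂_sub_one_eq {S : Type*} [CommRing S] (f : R →+* S) {P h : Polynomial R} {m : ℕ} (hn : h.natDegree ≤ m)
    (hP : P.comp (Polynomial.X - Polynomial.C 1) =
      ∑ j ∈ Finset.range (m + 1), Polynomial.C (h.coeff j) * Polynomial.X ^ (m - j) * (Polynomial.X ^ 2 + Polynomial.C 1) ^ j)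
    (x : Sˣ) : P.eval₂ f ((x : S) - 1) = (x : S) ^ m * h.eval₂ f ((x : S) + (x⁻¹ : Sˣ)) := by
  have h1 : P.eval₂ f ((x : S) - 1) = (P.comp (Polynomial.X - Polynomial.C 1)).eval₂ f x := by
    rw [Polynomial.eval₂_comp, Polynomial.eval₂_sub, Polynomial.eval₂_X, Polynomial.eval₂_C, map_one]
  rw [h1, hP, Polynomial.eval₂_eq_eval_map, transform_map, map_one f,
    eval_transform (1 : S) m (h.map f) ((Polynomial.natDegree_map_le).trans hn) x, one_mul, Polynomial.eval_map]

/-- `ζ = 1`: **`P(0) = h(2)`** (the trivial character / the Euler weight reads `h` at `2`).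
[cite: GoreskyTai2017RealStructuresOrdinary, App. §16.2 «p(x) = xⁿ h(x + q/x)» (p0036)] -/
theorem eval_zero_eq {P h : Polynomial R} {m : ℕ} (hn : h.natDegree ≤ m)
    (hP : P.comp (Polynomial.X - Polynomial.C 1) =
      ∑ j ∈ Finset.range (m + 1), Polynomial.C (h.coeff j) * Polynomial.X ^ (m - j) * (Polynomial.X ^ 2 + Polynomial.C 1) ^ j) :
    P.eval 0 = h.eval 2 := by
  have h1 := eval₂_sub_one_eq (RingHom.id R) hn hP 1
  simp only [Units.val_one, sub_self, one_pow, inv_one, one_mul, Polynomial.eval₂_id] at h1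
  rw [h1]; norm_num

/-- `ζ = −1`: **`P(−2) = (−1)^m · h(−2)`** (the order-`2` character / at `p = 2` the twin value reads `h` at `−2`).
[cite: GoreskyTai2017RealStructuresOrdinary, App. §16.2 «p(x) = xⁿ h(x + q/x)» (p0036)] -/
theorem eval_neg_two_eq {P h : Polynomial R} {m : ℕ} (hn : h.natDegree ≤ m)
    (hP : P.comp (Polynomial.X - Polynomial.C 1) =
      ∑ j ∈ Finset.range (m + 1), Polynomial.C (h.coeff j) * Polynomial.X ^ (m - j) * (Polynomial.X ^ 2 + Polynomial.C 1) ^ j) :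
    P.eval (-2) = (-1) ^ m * h.eval (-2) := by
  have h1 := eval₂_sub_one_eq (RingHom.id R) hn hP (-1)
  simp only [Units.val_neg, Units.val_one, inv_neg, inv_one, Polynomial.eval₂_id] at h1
  rw [show (-1 : R) - 1 = -2 by norm_num, show (-1 : R) + -1 = -2 by norm_num] at h1
  exact h1

/-- `ζ` with `ζ² = −1` (order `4`; at `p = 2` the LAYER-2 value): **`P(ζ − 1) = ζ^m · h(0)`** — it reads the CONSTANT coefficient of `h`.
[cite: GoreskyTai2017RealStructuresOrdinary, App. §16.2 «p(x) = xⁿ h(x + q/x)» (p0036)] -/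
theorem eval₂_sub_one_eq_of_sq_eq_neg_one {S : Type*} [CommRing S] (f : R →+* S) {P h : Polynomial R} {m : ℕ}
    (hn : h.natDegree ≤ m)
    (hP : P.comp (Polynomial.X - Polynomial.C 1) =
      ∑ j ∈ Finset.range (m + 1), Polynomial.C (h.coeff j) * Polynomial.X ^ (m - j) * (Polynomial.X ^ 2 + Polynomial.C 1) ^ j)
    {ζ : S} (hζ : ζ ^ 2 = -1) : P.eval₂ f (ζ - 1) = ζ ^ m * f (h.coeff 0) := by
  have hu : ζ * (-ζ) = 1 := by linear_combination (-1 : S) * hζ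
  set x : Sˣ := Units.mkOfMulEqOne ζ (-ζ) hu with hx
  have hx1 : (x : S) = ζ := rfl
  have hx2 : ((x⁻¹ : Sˣ) : S) = -ζ := rfl
  have h1 := eval₂_sub_one_eq f hn hP x
  rw [hx1, hx2, add_neg_cancel, Polynomial.eval₂_at_zero] at h1
  exact h1

/-- `ζ` with `ζ⁴ = −1` (order `8`; at `p = 2` the LAYER-3 value): **`P(ζ − 1) = ζ^m · h(s)` with `s = ζ − ζ³`, `s² = 2`** — it reads
`h` at a square root of `2` (a uniformiser of `ℚ₂(√2) = ℚ₁`, the first layer). [cite: GoreskyTai2017RealStructuresOrdinary, App. §16.2 «p(x) = xⁿ h(x + q/x)» (p0036)] -/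
theorem eval₂_sub_one_eq_of_pow_four_eq_neg_one {S : Type*} [CommRing S] (f : R →+* S) {P h : Polynomial R} {m : ℕ}
    (hn : h.natDegree ≤ m)
    (hP : P.comp (Polynomial.X - Polynomial.C 1) =
      ∑ j ∈ Finset.range (m + 1), Polynomial.C (h.coeff j) * Polynomial.X ^ (m - j) * (Polynomial.X ^ 2 + Polynomial.C 1) ^ j)
    {ζ : S} (hζ : ζ ^ 4 = -1) : P.eval₂ f (ζ - 1) = ζ ^ m * h.eval₂ f (ζ - ζ ^ 3) ∧ (ζ - ζ ^ 3) ^ 2 = 2 := by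
  have hu : ζ * (-ζ ^ 3) = 1 := by linear_combination (-1 : S) * hζ
  set x : Sˣ := Units.mkOfMulEqOne ζ (-ζ ^ 3) hu with hx
  have hx1 : (x : S) = ζ := rfl
  have hx2 : ((x⁻¹ : Sˣ) : S) = -ζ ^ 3 := rfl
  have h1 := eval₂_sub_one_eq f hn hP x
  rw [hx1, hx2, ← sub_eq_add_neg] at h1
  exact ⟨h1, by linear_combination (ζ ^ 2 - 2) * hζ⟩

end Values

/-! ## §2 At odd `p` the degree is even -/

section OddPrime

variable {p : ℕ} [hp : Fact p.Prime]

/-- ★★ **At odd `p` the degree is automatically even.** `p ≠ 2`, `F ≢ 0 (mod p)`, `F(0) ≠ 0`, `ι F = u·F` ⟹ `λ = deg P` is EVEN: were it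
odd, `P(−2) = 0` (`…LayerValuePalindrome`), but `P(−2) ≡ (−2)^λ ≢ 0 (mod p)` for a distinguished `P` and `p ∤ 2`. (At `p = 2` odd `λ`
does occur: `P = T + 2`.) [cite: GreenbergLNM1716, §5 p. 181] [cite: Washington1997, §7.1 (Weierstrass preparation, uniqueness)] -/
theorem even_natDegree_weierstrassDistinguished_of_odd_prime (hp2 : p ≠ 2) {F : IwasawaAlgebra p}
    (hred : F.map (IsLocalRing.residue ℤ_[p]) ≠ 0) (h0 : PowerSeries.constantCoeff F ≠ 0)
    (hι : ∃ u : (IwasawaAlgebra p)ˣ, invol p F = u * F) : Even (F.weierstrassDistinguished hred).natDegree := by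
  by_contra hodd
  rw [Nat.not_even_iff_odd] at hodd
  have hzero := eval_neg_two_weierstrassDistinguished_eq_zero_of_odd hred h0 hι hodd
  set P : Polynomial ℤ_[p] := F.weierstrassDistinguished hred with hP
  have hPd : P.IsDistinguishedAt (IsLocalRing.maximalIdeal ℤ_[p]) := F.isDistinguishedAt_weierstrassDistinguished hred
  set d := P.natDegree with hd
  -- `P(−2) − (−2)^d ∈ 𝔪`
  have hmem : P.eval (-2) - (-2) ^ d ∈ IsLocalRing.maximalIdeal ℤ_[p] := by
    rw [Polynomial.eval_eq_sum_range, ← hd, Finset.sum_range_succ, hPd.monic.coeff_natDegree, one_mul, add_sub_cancel_right]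
    refine Ideal.sum_mem _ fun k hk ↦ Ideal.mul_mem_right _ _ (hPd.mem ?_)
    rw [Finset.mem_range] at hk; rw [← hd]; exact hk
  rw [hzero, zero_sub] at hmem
  -- `2` is a unit of `ℤ_p` for `p ≠ 2`
  have h2 : IsUnit (2 : ℤ_[p]) := by
    rw [PadicInt.isUnit_iff]
    refine le_antisymm (PadicInt.norm_le_one _) (not_lt.mp fun hlt ↦ hp2 ?_)
    have h := (PadicInt.norm_int_lt_one_iff_dvd (p := p) 2).mp (by exact_mod_cast hlt)
    have h' : p ∣ 2 := by exact_mod_cast h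
    exact (Nat.prime_dvd_prime_iff_eq hp.out Nat.prime_two).mp h'
  have hunit : IsUnit (-(-2 : ℤ_[p]) ^ d) := (h2.neg.pow d).neg
  exact (IsLocalRing.maximalIdeal.isMaximal ℤ_[p]).ne_top (Ideal.eq_top_of_isUnit_mem _ hmem hunit)

end OddPrime

/-! ## §3 `ℂ_p`: every layer value descends — `|F(ζ − 1)| = p^{−μ(F)} · |h(ζ + ζ⁻¹)|` -/

section Layer

variable {p : ℕ} [hp : Fact p.Prime]

/-- ★★★ **ALL LAYER VALUES DESCEND TO THE REAL COUNTERPART.** `F ∈ Λ ∖ {0}` `ι`-stable with `F(0) ≠ 0`, `λ(F) = 2m`, `h` its real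
counterpart (`…HalfDescent.existsUnique_realCounterpart_of_lam`); then for every `ζ ∈ ℂ_p` with `|ζ| = 1`, `|ζ − 1| < 1` (e.g. any `p`-power root
of unity): **`|F(ζ − 1)| = p^{−μ(F)} · |h(ζ + ζ⁻¹)|`** — the value of `F` at the character `γ ↦ ζ` depends only on the REAL point `ζ + ζ⁻¹`,
through ONE polynomial of degree `λ/2`. (`F = p^μ·P·U`, `|U(ζ−1)| = 1`, `P(ζ−1) = ζ^m h(ζ+ζ⁻¹)`.) [cite: Washington1997, §7.1–7.2 and Thm. 7.3]
[cite: GoreskyTai2017RealStructuresOrdinary, App. §16.2 «p(x) = xⁿ h(x + q/x)» (p0036)] -/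
theorem norm_tsum_eq_norm_realCounterpart {F : IwasawaAlgebra p} (hF : F ≠ 0) {h : Polynomial ℤ_[p]} {m : ℕ} (hn : h.natDegree ≤ m)
    (hPh : ((pfree F).weierstrassDistinguished (red_pfree_ne_zero hF)).comp (Polynomial.X - Polynomial.C 1) =
      ∑ j ∈ Finset.range (m + 1), Polynomial.C (h.coeff j) * Polynomial.X ^ (m - j) * (Polynomial.X ^ 2 + Polynomial.C 1) ^ j)
    {ζ : ℂ_[p]} (hζ1 : ‖ζ‖ = 1) (hζ : ‖ζ - 1‖ < 1) :
    ‖∑' k, ((algebraMap ℚ_[p] ℂ_[p]).comp (algebraMap ℤ_[p] ℚ_[p])) (PowerSeries.coeff k F) * (ζ - 1) ^ k‖ =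
      ((p : ℝ)⁻¹) ^ mu F * ‖h.eval₂ ((algebraMap ℚ_[p] ℂ_[p]).comp (algebraMap ℤ_[p] ℚ_[p])) (ζ + ζ⁻¹)‖ := by
  rw [norm_tsum_eq_mul_norm_eval₂ (eq_C_pow_mu_mul_pfree F) (red_pfree_ne_zero hF) hζ]
  congr 1
  have hζ0 : ζ ≠ 0 := fun h0 ↦ by rw [h0, norm_zero] at hζ1; exact zero_ne_one hζ1
  have h1 := eval₂_sub_one_eq ((algebraMap ℚ_[p] ℂ_[p]).comp (algebraMap ℤ_[p] ℚ_[p])) hn hPh (Units.mk0 ζ hζ0)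
  rw [Units.val_inv_eq_inv_val, Units.val_mk0] at h1
  rw [h1, norm_mul, norm_pow, hζ1, one_pow, one_mul]

/-- ★★★ **At a `p`-power root of unity**: `ζ` of order `pⁿ⁺¹` ⟹ `|F(ζ − 1)| = p^{−μ(F)}·|h(ζ + ζ⁻¹)|`, `ζ + ζ⁻¹ ∈ ℚ_p(ζ)⁺`: the LAYER-`(n+1)`
value of the tree's one-value certificates (`Iwasawa/LambdaInvariantValuationLayer`, the lineage's `…LayerValueDoor`) is a value of the degree-`λ/2`
polynomial `h` on the REAL cyclotomic tower. [cite: Washington1997, §7.1–7.2 and Thm. 7.3] [cite: GoreskyTai2017RealStructuresOrdinary, App. §16.2 (p0036)] -/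
theorem norm_tsum_eq_norm_realCounterpart_of_isPrimitiveRoot {F : IwasawaAlgebra p} (hF : F ≠ 0) {h : Polynomial ℤ_[p]} {m : ℕ}
    (hn : h.natDegree ≤ m)
    (hPh : ((pfree F).weierstrassDistinguished (red_pfree_ne_zero hF)).comp (Polynomial.X - Polynomial.C 1) =
      ∑ j ∈ Finset.range (m + 1), Polynomial.C (h.coeff j) * Polynomial.X ^ (m - j) * (Polynomial.X ^ 2 + Polynomial.C 1) ^ j)
    {n : ℕ} {ζ : ℂ_[p]} (hζ : IsPrimitiveRoot ζ (p ^ (n + 1))) :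
    ‖∑' k, ((algebraMap ℚ_[p] ℂ_[p]).comp (algebraMap ℤ_[p] ℚ_[p])) (PowerSeries.coeff k F) * (ζ - 1) ^ k‖ =
      ((p : ℝ)⁻¹) ^ mu F * ‖h.eval₂ ((algebraMap ℚ_[p] ℂ_[p]).comp (algebraMap ℤ_[p] ℚ_[p])) (ζ + ζ⁻¹)‖ :=
  norm_tsum_eq_norm_realCounterpart hF hn hPh
    (norm_eq_one_of_pow_eq_one_padicComplex (pow_ne_zero _ hp.out.ne_zero) hζ.pow_eq_one) (norm_sub_one_pos_and_lt_one hζ).2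

/-- ★★★ **The order-`4` character reads the CONSTANT coefficient of `h`**: for `ζ ∈ ℂ_p` with `ζ² = −1` and `|ζ − 1| < 1` (so `p = 2`: the
LAYER-2 value of the lineage) **`|F(ζ − 1)| = p^{−μ(F)} · |h(0)|`** — a `p`-adic INTEGER invariant, no root of unity needed to state it.
[cite: Washington1997, §7.1–7.2 and Thm. 7.3] [cite: GoreskyTai2017RealStructuresOrdinary, App. §16.2 (p0036)] -/
theorem norm_tsum_eq_norm_coeff_zero_of_sq_eq_neg_one {F : IwasawaAlgebra p} (hF : F ≠ 0) {h : Polynomial ℤ_[p]} {m : ℕ}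
    (hn : h.natDegree ≤ m)
    (hPh : ((pfree F).weierstrassDistinguished (red_pfree_ne_zero hF)).comp (Polynomial.X - Polynomial.C 1) =
      ∑ j ∈ Finset.range (m + 1), Polynomial.C (h.coeff j) * Polynomial.X ^ (m - j) * (Polynomial.X ^ 2 + Polynomial.C 1) ^ j)
    {ζ : ℂ_[p]} (hζ2 : ζ ^ 2 = -1) (hζ : ‖ζ - 1‖ < 1) :
    ‖∑' k, ((algebraMap ℚ_[p] ℂ_[p]).comp (algebraMap ℤ_[p] ℚ_[p])) (PowerSeries.coeff k F) * (ζ - 1) ^ k‖ =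
      ((p : ℝ)⁻¹) ^ mu F * ‖h.coeff 0‖ := by
  rw [norm_tsum_eq_mul_norm_eval₂ (eq_C_pow_mu_mul_pfree F) (red_pfree_ne_zero hF) hζ,
    eval₂_sub_one_eq_of_sq_eq_neg_one _ hn hPh hζ2, norm_mul, norm_pow, norm_algebraMap_comp_apply]
  have hζ4 : ζ ^ 4 = 1 := by rw [show 4 = 2 * 2 by norm_num, pow_mul, hζ2]; norm_num
  rw [norm_eq_one_of_pow_eq_one_padicComplex (by norm_num) hζ4, one_pow, one_mul]

end Layer

/-! ## §4 The two `ℤ_p`-rational points: `F(0) = p^μ·h(2)·unit`, and at `p = 2` the twin `F(−2) = 2^μ·(−1)^m h(−2)·unit` -/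

section Dyadic

variable {p : ℕ} [hp : Fact p.Prime]

/-- ★★ **The trivial character reads `h(2)`**: `F(0) = p^{μ(F)} · h(2) · u`, `u ∈ ℤ_pˣ` (so `ord_p F(0) = μ(F) + ord_p h(2)`: the lineage's Euler
WEIGHT is `μ + v(h(2))`). [cite: Washington1997, §7.1 (Weierstrass preparation, uniqueness)] [cite: GoreskyTai2017RealStructuresOrdinary, App. §16.2 (p0036)] -/
theorem constantCoeff_eq_pow_mu_mul_eval_two {F : IwasawaAlgebra p} (hF : F ≠ 0) {h : Polynomial ℤ_[p]} {m : ℕ} (hn : h.natDegree ≤ m)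
    (hPh : ((pfree F).weierstrassDistinguished (red_pfree_ne_zero hF)).comp (Polynomial.X - Polynomial.C 1) =
      ∑ j ∈ Finset.range (m + 1), Polynomial.C (h.coeff j) * Polynomial.X ^ (m - j) * (Polynomial.X ^ 2 + Polynomial.C 1) ^ j) :
    ∃ u : ℤ_[p]ˣ, PowerSeries.constantCoeff F = (p : ℤ_[p]) ^ mu F * h.eval 2 * u := by
  set G := pfree F with hG
  have hred : G.map (IsLocalRing.residue ℤ_[p]) ≠ 0 := red_pfree_ne_zero hF
  have hfac : G = (G.weierstrassDistinguished hred : IwasawaAlgebra p) * G.weierstrassUnit hred :=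
    G.eq_weierstrassDistinguished_mul_weierstrassUnit hred
  have hU : IsUnit (PowerSeries.constantCoeff (G.weierstrassUnit hred)) :=
    PowerSeries.isUnit_iff_constantCoeff.mp (G.isUnit_weierstrassUnit hred)
  refine ⟨hU.unit, ?_⟩
  have hP0 : PowerSeries.constantCoeff ((G.weierstrassDistinguished hred : Polynomial ℤ_[p]) : IwasawaAlgebra p) = h.eval 2 := by
    rw [Polynomial.constantCoeff_coe, Polynomial.coeff_zero_eq_eval_zero]; exact eval_zero_eq hn hPh
  conv_lhs => rw [eq_C_pow_mu_mul_pfree F, ← hG, hfac]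
  rw [map_mul, map_mul, PowerSeries.constantCoeff_C, hP0, IsUnit.unit_spec, mul_assoc]

/-- ★★ **`p = 2`: the twin value reads `h(−2)`**: `F(−2) = 2^{μ(F)} · (−1)^m h(−2) · u`, `u ∈ ℤ₂ˣ` (so `ord₂ F(−2) = μ(F) + ord₂ h(−2)`: the
lineage's TWIN VALUE — the `χ₈`-twist / `W⁽²⁾` — is `μ + v(h(−2))`). [cite: Washington1997, §7.1 (Weierstrass preparation, uniqueness)]
[cite: GoreskyTai2017RealStructuresOrdinary, App. §16.2 (p0036)] -/
theorem evalAt_neg_two_eq_pow_mu_mul_eval_neg_two {F : IwasawaAlgebra 2} (hF : F ≠ 0) {h : Polynomial ℤ_[2]} {m : ℕ}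
    (hn : h.natDegree ≤ m)
    (hPh : ((pfree F).weierstrassDistinguished (red_pfree_ne_zero hF)).comp (Polynomial.X - Polynomial.C 1) =
      ∑ j ∈ Finset.range (m + 1), Polynomial.C (h.coeff j) * Polynomial.X ^ (m - j) * (Polynomial.X ^ 2 + Polynomial.C 1) ^ j) :
    ∃ u : ℤ_[2]ˣ, evalAt (-2 : ℤ_[2]) F = (2 : ℤ_[2]) ^ mu F * ((-1) ^ m * h.eval (-2)) * u := by
  set G := pfree F with hG
  have hred : G.map (IsLocalRing.residue ℤ_[2]) ≠ 0 := red_pfree_ne_zero hF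
  have hfac : G = (G.weierstrassDistinguished hred : IwasawaAlgebra 2) * G.weierstrassUnit hred :=
    G.eq_weierstrassDistinguished_mul_weierstrassUnit hred
  have hn2 : ‖(-2 : ℤ_[2])‖ < 1 := norm_neg_two_lt_one
  have hU : IsUnit (evalAt (-2 : ℤ_[2]) (G.weierstrassUnit hred)) := by
    have := (G.isUnit_weierstrassUnit hred).map (evalAtHom hn2); rwa [evalAtHom_apply] at this
  refine ⟨hU.unit, ?_⟩
  have hP2 : evalAt (-2 : ℤ_[2]) ((G.weierstrassDistinguished hred : Polynomial ℤ_[2]) : IwasawaAlgebra 2) = (-1) ^ m * h.eval (-2) := by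
    rw [evalAt_coe]; exact eval_neg_two_eq hn hPh
  have hC : evalAt (-2 : ℤ_[2]) (PowerSeries.C ((2 : ℤ_[2]) ^ mu F)) = (2 : ℤ_[2]) ^ mu F := by
    rw [← Polynomial.coe_C, evalAt_coe, Polynomial.eval_C]
  conv_lhs => rw [eq_C_pow_mu_mul_pfree F, ← hG, hfac]
  rw [evalAt_mul hn2, evalAt_mul hn2, Nat.cast_ofNat, hC, hP2, IsUnit.unit_spec]
  ring

end Dyadic

end Summit.BirchSwinnertonDyer.BirchSwinnertonDyer.Theorems.AlignedTransportAtTwoHalfDescentValues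

end
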